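import Summits.RiemannHypothesis.RiemannHypothesis.Theses.SignCone
import Summits.RiemannHypothesis.RiemannHypothesis.Theorems.SignConeSignConeDuality
import Summits.RiemannHypothesis.RiemannHypothesis.Theorems.SignConeDuality.Negative.ConeMultipliersLoadBearing
import Summits.RiemannHypothesis.RiemannHypothesis.Theorems.SignConeDuality.Negative.HypothesisLoadBearing
import Literature.NumberTheory.LFunctions.WeilWindowSimpleEven

/-!
# Disproof attempts — crux `SignCone.SignConeDuality` (stmt-RiemannHypothesis-16304)

cdisprove seat `refuter-cdisprove-stmt-RiemannHypothesis-16304-0`, cycle 1 (2026-08-16), v2.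

## Outcome

**NO KILL — and the crux is now PROVED** (`Theorems.SignConeDuality.SignConeDuality_of`,
`Theorems/SignConeSignConeDuality.lean` @ b13840cce207, line `Sketch` = ratio-induction multipliers;
item closed `proved` 2026-08-16T22:19Z). The crux is `∀ a > 0, Hyp a → Dual a`
(`signConeDuality_iff`, `Iff.rfl`): `Hyp a` = the unit-slack sign-cone inequality at cutoff `a`
(body of the route target `SignConeInequality` at `a`), `Dual a` = the antecedent of crux
`ConeMagnification` at `a`. It is finite-dimensional Lagrange duality with an explicit Slater point;
both sides are RH-true, so nothing numeric could ever have refuted the implication. What this seat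
LANDED (all sorry-free, standard axioms, `--supports stmt-RiemannHypothesis-16304`):

* p128611 `Theorems/SignConeDuality/Negative/ConeMultipliersLoadBearing.lean` — ENGINE LEVEL:
  `coneMultipliers_false_without_slater`, `coneMultipliers_false_without_add` (explicit cones in
  `ℝ × (Fin 1 → ℝ)`): the Slater point and closure under `+` (= the FAMILY quantifier `k` of `Hyp a`)
  are each load-bearing for every multiplier engine on record; the strict node window
  `{2 ≤ n < e^{2a}}` is forced.
* p128684 `Theorems/SignConeDuality/Negative/HypothesisLoadBearing.lean` — HYPOTHESIS LEVEL:
  `signConeDuality_dual_of_nonpos` (guard `0 < a` is decoration), `signConeDuality_dual_of_le_log_two_half`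
  + `signConeDuality_smallCutoff` (`a ≤ (log 2)/2`: `Dual a` UNCONDITIONAL, Yoshida — the hypothesis
  is not load-bearing at small cutoffs), `signConeDuality_dual_of_riemannHypothesis` (`RH → ∀ a, Dual a`,
  `c = Λ`) and `signConeDuality_withoutHyp_iff_riemannHypothesis` (modulo `ConeMagnification` the
  hypothesis-DELETED crux `↔ RH`): no `_false_without_Hyp` can exist short of `¬RH`.
* p128964 `Theorems/SignConeDuality/Negative/Tightness.lean` — TIGHTNESS: the CONVERSE of the crux
  for every weight, `signConeDuality_hyp_of_dualWith` (any `c ≥ 0` with unit slack ⇒ `Hyp a`; no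
  `c 1 = 0` / support / summability condition: the fake prime term is a finite sum over
  `n < ⌈e^{2a}⌉` for EVERY `c`), `signConeDuality_converse` (`Dual a → Hyp a`), hence with the proved
  crux `Hyp a ↔ Dual a` at every cutoff (`hyp_iff_dual` below): the hypothesis is EXACTLY as strong
  as the conclusion, the unit constants and the weight `n^{-1/2}` are forced to match; plus
  `signConeDuality_hyp_of_le_log_two_half` (the route TARGET at `a ≤ (log 2)/2` is a theorem),
  `signConeDuality_hyp_of_riemannHypothesis` and kill propagation
  `not_riemannHypothesis_of_not_signConeInequality` / `not_riemannHypothesis_of_not_dual`.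

This file is now the INDEX: §A shape certificates; §B one-line corollaries of the landed theorems in
the `Hyp`/`Dual` vocabulary (B5 carries its own copy of the converse's proof, identical to the landed
`Negative/Tightness.lean`, so that this workfile does not depend on that module's build); §C notes.

## For the remaining cruxes of the route (hand-over)

* `SignConeInequality` (target, 16301) = `∀ a > 0, Hyp a`: RH-implied (`hyp_of_riemannHypothesis`),
  unconditional for `a ≤ (log 2)/2` (`hyp_of_le_log_two_half`); a refutation at any cutoff disproves
  RH (`Tightness.not_riemannHypothesis_of_not_signConeInequality`).
* `ConeMagnification` (16303): its antecedent `∀ a > 0, Dual a` is, cutoff by cutoff, EQUIVALENT to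
  the target (`hyp_iff_dual`), so `ConeMagnification ↔ (SignConeInequality → RH)` — the magnification
  crux is exactly "target ⇒ RH", no more, no less (`coneMagnification_iff_target_implies_summit`).
-/

set_option linter.dupNamespace false

noncomputable section

open scoped BigOperators ArithmeticFunction.vonMangoldt
open MeasureTheory Set Literature.NumberTheory.LFunctions
open Summit.RiemannHypothesis.RiemannHypothesis.Theorems.SignConeDuality.Negative

namespace Summit.RiemannHypothesis.RiemannHypothesis.Cruxes.SignConeDuality.Disproof

/-! ## §A Shape of the crux (verbatim sub-formulas of the route decl) -/

/-- `Hyp a`: the unit-slack sign-cone inequality at cutoff `a` — VERBATIM the hypothesis of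
`SignConeDuality` at `a` (and the body of the target `SignConeInequality` at `a`). -/
def Hyp (a : ℝ) : Prop :=
  ∀ (k : ℕ) (g : Fin k → ℝ → ℂ), (∀ i, (ContDiff ℝ ((⊤ : ℕ∞) : WithTop ℕ∞) (g i) ∧ HasCompactSupport (g i)) ∧ tsupport (g i) ⊆ Set.Icc (-a) a) → let F : ℝ → ℂ := fun t => ∑ i, MeasureTheory.convolution (g i) (fun u => (starRingEnd ℂ) ((g i) (-u))) (ContinuousLinearMap.mul ℂ ℂ) MeasureTheory.MeasureSpace.volume t; (∀ n : ℕ, 2 ≤ n → 0 ≤ (F (Real.log n)).re) → let M : ℂ → ℂ := fun s => ∫ u : ℝ, F u * Complex.exp ((s - 1 / 2) * u); -(F 0).re ≤ (M 0 + M 1 + ((1 / (2 * Real.pi) : ℂ) * (∫ t : ℝ, M (1 / 2 + t * Complex.I) * ((Complex.digamma (1 / 4 + t / 2 * Complex.I)).re : ℂ)) - F 0 * (Real.log Real.pi : ℂ))).re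

/-- `DualWith a c`: the fake Weil form with weight `c` has unit slack on every single test
supported in `[-a, a]` — VERBATIM the matrix of the conclusion of `SignConeDuality`. -/
def DualWith (a : ℝ) (c : ℕ → ℝ) : Prop :=
  ∀ g : ℝ → ℂ, (ContDiff ℝ ((⊤ : ℕ∞) : WithTop ℕ∞) g ∧ HasCompactSupport g) → tsupport g ⊆ Set.Icc (-a) a → let G : ℝ → ℂ := MeasureTheory.convolution g (fun u => (starRingEnd ℂ) (g (-u))) (ContinuousLinearMap.mul ℂ ℂ) MeasureTheory.MeasureSpace.volume; let M : ℂ → ℂ := fun s => ∫ u : ℝ, G u * Complex.exp ((s - 1 / 2) * u); -(∫ t, ‖g t‖ ^ 2) ≤ (M 0 + M 1 + ((1 / (2 * Real.pi) : ℂ) * (∫ t : ℝ, M (1 / 2 + t * Complex.I) * ((Complex.digamma (1 / 4 + t / 2 * Complex.I)).re : ℂ)) - G 0 * (Real.log Real.pi : ℂ)) - ∑' n : ℕ, ((c n : ℝ) : ℂ) / (Real.sqrt n : ℂ) * (G (Real.log n) + G (-Real.log n))).re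

/-- `Dual a`: SOME nonnegative weight `c` with `c 1 = 0` has unit slack at cutoff `a` — VERBATIM
the conclusion of `SignConeDuality` at `a` (= antecedent of `ConeMagnification` at `a`). -/
def Dual (a : ℝ) : Prop :=
  ∃ c : ℕ → ℝ, (∀ n, 0 ≤ c n) ∧ c 1 = 0 ∧ DualWith a c

/-- Shape certificate: the crux IS `∀ a > 0, Hyp a → Dual a`, definitionally. -/
theorem signConeDuality_iff :
    Theses.SignCone.SignConeDuality ↔ ∀ a : ℝ, 0 < a → Hyp a → Dual a :=
  Iff.rfl

/-- Shape certificate: the target IS `∀ a > 0, Hyp a`, definitionally. -/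
theorem signConeInequality_iff :
    Theses.SignCone.SignConeInequality ↔ ∀ a : ℝ, 0 < a → Hyp a :=
  Iff.rfl

/-- Shape certificate: `ConeMagnification` IS `(∀ a > 0, Dual a) → RH`, definitionally. -/
theorem coneMagnification_iff :
    Theses.SignCone.ConeMagnification ↔ ((∀ a : ℝ, 0 < a → Dual a) → Summit.RiemannHypothesis) :=
  Iff.rfl

/-! ## §B Load-bearing analysis and tightness (corollaries of the landed `Negative/` theorems) -/

/-- B1 — the guard `0 < a` is decoration: `Dual a` for `a ≤ 0` (only `g = 0` is admissible). -/
theorem dual_of_nonpos {a : ℝ} (ha : a ≤ 0) : Dual a :=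
  signConeDuality_dual_of_nonpos a ha

/-- B2 — at small cutoffs the hypothesis is not load-bearing: `Dual a` UNCONDITIONALLY for
`a ≤ (log 2)/2` (Yoshida, `c = Λ`). -/
theorem dual_of_le_log_two_half {a : ℝ} (ha : a ≤ Real.log 2 / 2) : Dual a :=
  signConeDuality_dual_of_le_log_two_half a ha

/-- B3 — deleting the hypothesis leaves an RH-true statement: `RH → Dual a` at every cutoff
(`c = Λ`); so no `_false_without_Hyp` exists short of `¬RH`. -/
theorem dual_of_riemannHypothesis (hRH : Summit.RiemannHypothesis) (a : ℝ) : Dual a :=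
  signConeDuality_dual_of_riemannHypothesis hRH a

/-- The crux with its hypothesis DELETED (= antecedent of `ConeMagnification`). -/
def SignConeDualityWithoutHyp : Prop :=
  ∀ a : ℝ, 0 < a → Dual a

/-- B3'' — modulo `ConeMagnification`, the hypothesis-free form is equivalent to the summit. -/
theorem withoutHyp_iff_riemannHypothesis (hMag : Theses.SignCone.ConeMagnification) :
    SignConeDualityWithoutHyp ↔ Summit.RiemannHypothesis :=
  signConeDuality_withoutHyp_iff_riemannHypothesis hMag

/-- B4 — engine level (see `Negative/ConeMultipliersLoadBearing.lean`): re-exported statements. -/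
theorem engine_needs_slater_and_add :
    (¬ ∀ (S : Set (ℝ × (Fin 1 → ℝ))),
        (0 : ℝ × (Fin 1 → ℝ)) ∈ S → Convex ℝ S →
        (∀ x ∈ S, ∀ y ∈ S, x + y ∈ S) →
        (∀ r : ℝ, 0 < r → ∀ x ∈ S, r • x ∈ S) →
        (∀ x ∈ S, (∀ i, 0 ≤ x.2 i) → 0 ≤ x.1) →
        ∃ l : Fin 1 → ℝ, (∀ i, 0 ≤ l i) ∧ ∀ x ∈ S, ∑ i, l i * x.2 i ≤ x.1) ∧
    (¬ ∀ (S : Set (ℝ × (Fin 1 → ℝ))),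
        (0 : ℝ × (Fin 1 → ℝ)) ∈ S →
        (∀ r : ℝ, 0 < r → ∀ x ∈ S, r • x ∈ S) →
        (∀ x ∈ S, (∀ i, 0 ≤ x.2 i) → 0 ≤ x.1) →
        (∃ x ∈ S, ∀ i, 0 < x.2 i) →
        ∃ l : Fin 1 → ℝ, (∀ i, 0 ≤ l i) ∧ ∀ x ∈ S, ∑ i, l i * x.2 i ≤ x.1) :=
  ⟨coneMultipliers_false_without_slater, coneMultipliers_false_without_add⟩

/-! ### B5 — tightness: the converse of the crux (proof; landed copy = `Negative/Tightness.lean`) -/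

/-- The fake prime term with weight `c`. -/
def fakePrime (c : ℕ → ℝ) (K : ℝ → ℂ) : ℂ :=
  ∑' n : ℕ, ((c n : ℝ) : ℂ) / (Real.sqrt n : ℂ) * (K (Real.log n) + K (-Real.log n))

theorem isWeilTest_sum {ι : Type*} (s : Finset ι) (G : ι → ℝ → ℂ) (hG : ∀ i, IsWeilTest (G i)) :
    IsWeilTest (∑ i ∈ s, G i) := by
  classical
  refine Finset.induction_on s ?_ ?_
  · rw [Finset.sum_empty]
    exact ⟨contDiff_const, HasCompactSupport.zero⟩
  · intro a s ha ih
    rw [Finset.sum_insert ha]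
    exact (hG a).add ih

theorem archPolar_zero : weilPolarTerm (0 : ℝ → ℂ) + weilArchTerm 0 = 0 := by
  simp [weilPolarTerm, weilArchTerm, weilArchIntegral, weilMellin]

/-- Additivity of the prime-free Weil form over finite families of test kernels. -/
theorem archPolar_sum {ι : Type*} (s : Finset ι) (G : ι → ℝ → ℂ) (hG : ∀ i, IsWeilTest (G i)) :
    weilPolarTerm (∑ i ∈ s, G i) + weilArchTerm (∑ i ∈ s, G i) =
      ∑ i ∈ s, (weilPolarTerm (G i) + weilArchTerm (G i)) := by
  classical
  refine Finset.induction_on s ?_ ?_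
  · simpa using archPolar_zero
  · intro a s ha ih
    rw [Finset.sum_insert ha, Finset.sum_insert ha, ← ih]
    have hS := isWeilTest_sum s G hG
    simp only [weilPolarTerm, weilArchTerm, weilArchIntegral_add (hG a) hS,
      weilMellin_add (hG a).1.continuous (hG a).2 hS.1.continuous hS.2, Pi.add_apply]
    ring

/-- The autocorrelation of a test supported in `[-a, a]` vanishes at every `|t| ≥ 2a`. -/
theorem autocorr_eq_zero_of_le_abs {a : ℝ} {g : ℝ → ℂ} (hg : Continuous g)
    (hsupp : tsupport g ⊆ Icc (-a) a) {t : ℝ} (ht : 2 * a ≤ |t|) :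
    weilConv g (weilReflect g) t = 0 := by
  rw [weilConv_apply]
  have hzero : (fun u => g u * weilReflect g (t - u)) = fun _ => 0 := by
    funext u
    simp only [weilReflect, neg_sub]
    by_cases hu : g u = 0
    · simp [hu]
    · have hu' := Theorems.SignConeDuality.farNode_mem_Ioo_of_apply_ne_zero hg hsupp hu
      have hut : g (u - t) = 0 := by
        by_contra h
        have h' := Theorems.SignConeDuality.farNode_mem_Ioo_of_apply_ne_zero hg hsupp h
        have : |t| < 2 * a := by
          rw [abs_lt]
          constructor <;> linarith [hu'.1, hu'.2, h'.1, h'.2]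
        linarith
      simp [hut]
  rw [hzero, integral_zero]

/-- Far nodes: for `n ≥ ⌈e^{2a}⌉` both `G(log n)` and `G(-log n)` vanish. -/
theorem autocorr_node_eq_zero {a : ℝ} {g : ℝ → ℂ} (hg : Continuous g)
    (hsupp : tsupport g ⊆ Icc (-a) a) {n : ℕ} (hn : ⌈Real.exp (2 * a)⌉₊ ≤ n) :
    weilConv g (weilReflect g) (Real.log n) = 0 ∧ weilConv g (weilReflect g) (-Real.log n) = 0 := by
  have hn' : Real.exp (2 * a) ≤ n := (Nat.le_ceil _).trans (by exact_mod_cast hn)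
  have hpos : (0 : ℝ) < n := (Real.exp_pos _).trans_le hn'
  have hlog : 2 * a ≤ Real.log n := by
    rw [Real.le_log_iff_exp_le hpos]
    exact hn'
  have h2a : 2 * a ≤ |Real.log n| := hlog.trans (le_abs_self _)
  exact ⟨autocorr_eq_zero_of_le_abs hg hsupp h2a,
    autocorr_eq_zero_of_le_abs hg hsupp (by rwa [abs_neg])⟩

/-- The fake prime term of an autocorrelation at cutoff `a` is a finite sum over `n < ⌈e^{2a}⌉`,
for EVERY weight `c`. -/
theorem fakePrime_eq_sum {a : ℝ} (c : ℕ → ℝ) {g : ℝ → ℂ} (hg : Continuous g)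
    (hsupp : tsupport g ⊆ Icc (-a) a) :
    fakePrime c (weilConv g (weilReflect g)) =
      ∑ n ∈ Finset.range ⌈Real.exp (2 * a)⌉₊, ((c n : ℝ) : ℂ) / (Real.sqrt n : ℂ) *
        (weilConv g (weilReflect g) (Real.log n) + weilConv g (weilReflect g) (-Real.log n)) := by
  unfold fakePrime
  refine tsum_eq_sum fun n hn => ?_
  rw [Finset.mem_range, not_lt] at hn
  obtain ⟨h1, h2⟩ := autocorr_node_eq_zero hg hsupp hn
  simp [h1, h2]

/-- Core of the converse: summing the single-test unit-slack inequalities over a family and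
dropping the (nonnegative) fake prime term of a node-nonnegative sum. -/
theorem sum_ineq {ι : Type*} (s : Finset ι) {a : ℝ} {c : ℕ → ℝ} (hc : ∀ n, 0 ≤ c n)
    (g : ι → ℝ → ℂ) (hg : ∀ i, IsWeilTest (g i)) (hsupp : ∀ i, tsupport (g i) ⊆ Icc (-a) a)
    (hD : ∀ i, -(∫ t, ‖g i t‖ ^ 2) ≤ (weilPolarTerm (weilConv (g i) (weilReflect (g i))) +
      weilArchTerm (weilConv (g i) (weilReflect (g i))) -
        fakePrime c (weilConv (g i) (weilReflect (g i)))).re)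
    (hn : ∀ n : ℕ, 2 ≤ n → 0 ≤ ((∑ i ∈ s, weilConv (g i) (weilReflect (g i))) (Real.log n)).re) :
    -((∑ i ∈ s, weilConv (g i) (weilReflect (g i))) 0).re ≤
      (weilPolarTerm (∑ i ∈ s, weilConv (g i) (weilReflect (g i))) +
        weilArchTerm (∑ i ∈ s, weilConv (g i) (weilReflect (g i)))).re := by
  set K : ι → ℝ → ℂ := fun i => weilConv (g i) (weilReflect (g i)) with hK
  have hKW : ∀ i, IsWeilTest (K i) := fun i => (hg i).weilConv (hg i).weilReflect
  -- F(0) = Σ ‖g_i‖²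
  have hF0 : ((∑ i ∈ s, K i) 0).re = ∑ i ∈ s, ∫ t, ‖g i t‖ ^ 2 := by
    rw [Finset.sum_apply, Complex.re_sum]
    refine Finset.sum_congr rfl fun i _ => ?_
    simp only [hK, weilConv_weilReflect_apply_zero, Complex.ofReal_re]
  have hF0' : 0 ≤ ((∑ i ∈ s, K i) 0).re := by
    rw [hF0]
    exact Finset.sum_nonneg fun i _ => integral_nonneg fun _ => by positivity
  -- additivity of the prime-free form
  have hW := archPolar_sum s K hKW
  -- the fake prime terms, summed over the family, are nonnegative
  set N := ⌈Real.exp (2 * a)⌉₊ with hN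
  have hP : ∀ i, fakePrime c (K i) = ∑ n ∈ Finset.range N, ((c n : ℝ) : ℂ) / (Real.sqrt n : ℂ) *
      (K i (Real.log n) + K i (-Real.log n)) :=
    fun i => fakePrime_eq_sum c (hg i).1.continuous (hsupp i)
  have hsymm : ∀ t : ℝ, ((∑ i ∈ s, K i) (-t)).re = ((∑ i ∈ s, K i) t).re := by
    intro t
    rw [Finset.sum_apply, Finset.sum_apply, Complex.re_sum, Complex.re_sum]
    refine Finset.sum_congr rfl fun i _ => ?_
    simp only [hK]
    rw [← conj_weilConv_weilReflect_neg (g i) t, Complex.conj_re]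
  have hnode : ∀ n : ℕ, 0 ≤ ((∑ i ∈ s, K i) (Real.log n)).re := by
    intro n
    rcases Nat.lt_or_ge n 2 with hlt | hge
    · interval_cases n <;> simpa using hF0'
    · exact hn n hge
  have hPsum : 0 ≤ (∑ i ∈ s, fakePrime c (K i)).re := by
    simp_rw [hP]
    rw [Finset.sum_comm, Complex.re_sum]
    refine Finset.sum_nonneg fun n _ => ?_
    rw [← Finset.mul_sum, Finset.sum_add_distrib]
    have h1 : ∑ i ∈ s, K i (Real.log n) = (∑ i ∈ s, K i) (Real.log n) := by
      rw [Finset.sum_apply]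
    have h2 : ∑ i ∈ s, K i (-Real.log n) = (∑ i ∈ s, K i) (-Real.log n) := by
      rw [Finset.sum_apply]
    rw [h1, h2]
    have hcoef : ((c n : ℝ) : ℂ) / (Real.sqrt n : ℂ) = ((c n / Real.sqrt n : ℝ) : ℂ) := by
      push_cast
      ring
    rw [hcoef, Complex.re_ofReal_mul, Complex.add_re, hsymm]
    refine mul_nonneg (div_nonneg (hc n) (Real.sqrt_nonneg _)) ?_
    linarith [hnode n]
  -- sum the single-test inequalities
  have hsum : ∑ i ∈ s, (-(∫ t, ‖g i t‖ ^ 2)) ≤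
      ∑ i ∈ s, (weilPolarTerm (K i) + weilArchTerm (K i) - fakePrime c (K i)).re :=
    Finset.sum_le_sum fun i _ => hD i
  have hsplit : ∑ i ∈ s, (weilPolarTerm (K i) + weilArchTerm (K i) - fakePrime c (K i)).re =
      (∑ i ∈ s, (weilPolarTerm (K i) + weilArchTerm (K i))).re - (∑ i ∈ s, fakePrime c (K i)).re := by
    rw [Complex.re_sum, Complex.re_sum, ← Finset.sum_sub_distrib]
    refine Finset.sum_congr rfl fun i _ => ?_
    rw [Complex.sub_re]
  rw [hF0, hW]
  rw [Finset.sum_neg_distrib] at hsum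
  linarith

/-- B5 — TIGHTNESS: the converse of the crux for every weight `c ≥ 0` (no `c 1 = 0`, no support or
summability condition on `c`): `DualWith a c → Hyp a`. Landed verbatim-inline as
`Negative.Tightness.signConeDuality_hyp_of_dualWith` (p128964). -/
theorem hyp_of_dualWith {a : ℝ} {c : ℕ → ℝ} (hc : ∀ n, 0 ≤ c n) (hD : DualWith a c) : Hyp a := by
  intro k g hg F hn M
  have hgW : ∀ i, IsWeilTest (g i) := fun i => (hg i).1
  have hF : F = ∑ i, weilConv (g i) (weilReflect (g i)) := by
    funext t
    show (∑ i, weilConv (g i) (weilReflect (g i)) t) = (∑ i, weilConv (g i) (weilReflect (g i))) t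
    rw [Finset.sum_apply]
  have hDi : ∀ i, -(∫ t, ‖g i t‖ ^ 2) ≤ (weilPolarTerm (weilConv (g i) (weilReflect (g i))) +
      weilArchTerm (weilConv (g i) (weilReflect (g i))) -
        fakePrime c (weilConv (g i) (weilReflect (g i)))).re :=
    fun i => hD (g i) (hg i).1 (hg i).2
  have hn' : ∀ n : ℕ, 2 ≤ n →
      0 ≤ ((∑ i, weilConv (g i) (weilReflect (g i))) (Real.log n)).re := by
    intro n h2
    have := hn n h2
    rwa [hF] at this
  show -(F 0).re ≤ (weilPolarTerm F + weilArchTerm F).re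
  rw [hF]
  exact sum_ineq Finset.univ hc g hgW (fun i => (hg i).2) hDi hn'

/-- B5' — `Dual a → Hyp a`. -/
theorem hyp_of_dual {a : ℝ} (h : Dual a) : Hyp a := by
  obtain ⟨c, hc, -, hD⟩ := h
  exact hyp_of_dualWith hc hD

/-- B2' — likewise the hypothesis itself (= the route target at cutoff `a`) is an unconditional
theorem for `a ≤ (log 2)/2`. -/
theorem hyp_of_le_log_two_half {a : ℝ} (ha : a ≤ Real.log 2 / 2) : Hyp a :=
  hyp_of_dual (dual_of_le_log_two_half ha)

/-- B3' — and `RH → Hyp a` at every cutoff (the route target is RH-implied). -/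
theorem hyp_of_riemannHypothesis (hRH : Summit.RiemannHypothesis) (a : ℝ) : Hyp a :=
  hyp_of_dual (dual_of_riemannHypothesis hRH a)

/-- B5'' — with the crux now PROVED in tree (`SignConeDuality_of`), hypothesis and conclusion are
EQUIVALENT at every cutoff `a > 0`: the statement was tight — no weaker hypothesis gives `Dual a`,
no stronger conclusion follows from `Hyp a`. -/
theorem hyp_iff_dual {a : ℝ} (ha : 0 < a) : Hyp a ↔ Dual a :=
  ⟨Theorems.SignConeDuality.SignConeDuality_of a ha, hyp_of_dual⟩

/-- Hand-over to crux 16303: `ConeMagnification` is EXACTLY "target ⇒ summit". -/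
theorem coneMagnification_iff_target_implies_summit :
    Theses.SignCone.ConeMagnification ↔
      (Theses.SignCone.SignConeInequality → Summit.RiemannHypothesis) := by
  constructor
  · intro hMag hX
    exact hMag fun a ha => (hyp_iff_dual ha).1 (hX a ha)
  · intro h hD
    exact h fun a ha => (hyp_iff_dual ha).2 (hD a ha)

/-- Kill propagation: `¬ Dual a` at any cutoff, or `¬ Hyp a` at any cutoff, disproves RH. -/
theorem not_riemannHypothesis_of_not_hyp {a : ℝ} (h : ¬ Hyp a) : ¬ Summit.RiemannHypothesis :=
  fun hRH => h (hyp_of_riemannHypothesis hRH a)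

/-! ## §C NOTES — natural strengthenings / weakenings and why none is attackable here

* Uniform weight across cutoffs (`∃ c, ∀ a, DualWith a c`, quantifier swap): RH-TRUE with `c = Λ`
  (`HypothesisLoadBearing.signConeDuality_dualWith_vonMangoldt_of_weilPositivityOn` + Weil
  criterion) — not refutable short of `¬RH`; its converse direction is the 2001 rigidity /
  magnification content (cruxes 16303 / 16306).
* Zero slack in the conclusion (exact cone `K_a ≠ ∅` from the UNIT-slack hypothesis): would need a
  cutoff with `μ(a) < 0 ≤ μ(a) + 1`; the sign of the exact margin `μ(a)` beyond `x = 210` is open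
  (route NUMBERS) — no small model, nothing to compute in-Lean.
* Hypothesis asked only of single autocorrelations (`k = 1`): by `coneMultipliers_false_without_add`
  the engine gives nothing; whether the WEIL moment cone happens to satisfy the `k = 1 ⇒ all k`
  upgrade is a multi-constraint S-lemma question with no general positive answer.
* `∀ c` in place of `∃ c`: false at every `a > (log 2)/2` (take `c = t·δ₂`, `t → ∞`, against the
  Slater bump with `Re G(log 2) > 0`) — a strawman nobody states; not written out.
* Junk audit (independent re-read, agrees with the rattack record): `n = 0` summand is
  `c 0 / √0 · (…) = c 0 / 0 · (…) = 0`; `n = 1` killed by `c 1 = 0` (and not even needed for the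
  converse); for EVERY `c` the `tsum` is finitely supported (`Tightness.fakePrime_eq_sum`); boundary
  node `e^{2a} ∈ ℕ` is the zero functional (`Tightness.autocorr_eq_zero_of_le_abs`); all integrals are
  Bochner integrals of integrable functions for `C_c^∞` data, so the prime-free form is additive over
  families (`Tightness.archPolar_sum`).

## §D Targets

None: the line `Sketch` was picked and ALL its stubs landed within the cycle (crux proved); no
`stuck_stubs` were ever issued to this seat.
-/

end Summit.RiemannHypothesis.RiemannHypothesis.Cruxes.SignConeDuality.Disproof

end
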